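import Literature.Algebra.Polynomial.CircuitNumberNonnegativity

/-!
# Soundness of SONC and SAGE decompositions (certified lower bounds)

[cite: MagronSeidlerDewolff2019, §2.2 (program (SONC) and «Hence, b₀ − GP_opt is a lower bound
of p on ℝⁿ»), Definition 3, §2.3 (Theorem 2.4, (SAGE-feas), program (SAGE)), §4 ((INTSAGE-feas))]
[cite: ChandrasekaranShah2016, §2.2, Definition 2 («As each term in a SAGE decomposition is
globally nonnegative, it is easily seen that SAGE functions are globally nonnegative»)]

This file records, as fully proved statements, what an *exact* SONC / SAGE verifier
(`optsonc`, `optsage`, `intsage` of Magron–Seidler–de Wolff) actually certifies once it has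
checked finitely many (in)equalities between exact numbers: the *soundness* of the two
relaxations, i.e. the passage from per-circuit / per-AGE certificates (the subject of
`Literature.Algebra.Polynomial.CircuitNumberNonnegativity`) to a global lower bound of the
whole polynomial or signomial.

* `sonc_lowerBound` — program (SONC) of Magron–Seidler–de Wolff §2.2: for a polynomial
  `p = ∑_{α ∈ MoSq} b_α x^α + ∑_{β ∈ NoSq} c_β x^β` (monomial squares `α` even, one of them
  the constant monomial `0`), a matrix `X ≥ 0` of circuit coefficients and barycentric weights
  `w` (the covering), the finitely many checks «column sums `∑_β X_{β,α} ≤ b_α` for `α ≠ 0`»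
  and «each circuit `(X_{β,·}, c_β)` passes the circuit-number test» imply
  `p(x) ≥ b₀ − ∑_β X_{β,0}` for every real `x`.  `sonc_nonneg` is the membership form
  (Definition 3: a sum of nonnegative circuit polynomials is nonnegative).
* `sage_nonneg` — (SAGE-feas) of Theorem 2.4 / Chandrasekaran–Shah Definition 2: coefficient
  vectors `c^{(j)}` summing to the coefficient vector of `f`, and for each `j` a vector `ν^{(j)}`
  with the balance condition `∑_i α(i) ν_i^{(j)} = 0`, `ν_j^{(j)} = −1·ν_{∖j}^{(j)}`,
  `ν_{∖j}^{(j)} ≥ 0` and the relative-entropy inequality `D(ν_{∖j}, e c_{∖j}) ≤ c_j^{(j)}`, imply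
  `f ≥ 0` on `ℝⁿ`; `sage_lowerBound` is the program (SAGE) form `f ≥ λ`.

Typing remarks.
* The covering `Circ^β ⊆ MoSq(p)` of the source is encoded by allowing zero weights and zero
  entries of `X` off the cover (the circuit-number lemmas of the imported file allow `w ≥ 0`).
* In the SAGE statements the off-diagonal coefficients are required to be *strictly* positive,
  `c_{∖j}^{(j)} > 0`, as in (INTSAGE-feas) of §4: with Lean's junk value `Real.log 0 = 0` the
  entropy term does not blow up at a zero coefficient, so the literal non-strict (SAGE-feas)
  would not be a sound hypothesis about `vecRelEntropy`; a zero coefficient is handled by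
  dropping that term from the index type.
* No named facts: every statement below is proved from the circuit-number file.
-/

namespace Literature.Algebra.Polynomial.SoncSageDecompositions

open Finset Literature.Algebra.Polynomial.CircuitNumberNonnegativity

/-! ## SONC: program (SONC) certifies a lower bound -/

section Sonc

variable {n : Type*} [Fintype n] {A : Type*} [Fintype A] [DecidableEq A] {B : Type*} [Fintype B]

/-- **Soundness of the SONC relaxation** (Magron–Seidler–de Wolff, program (SONC) of §2.2 and
the output `(X, C)` of Algorithm 3.1 `optsonc`).  Data: monomial squares indexed by `A` with
even exponents `e a` and coefficients `b a`, the constant monomial being `a₀` (`e a₀ = 0`);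
monomial non-squares indexed by `B` with exponents `f β` and coefficients `c β`; a certificate
`(X, w)`: nonnegative circuit coefficients `X β a` and barycentric weights `w β a` writing each
`f β` as a convex combination of the `e a`.  Checks: the column sums `∑_β X β a ≤ b a` for
`a ≠ a₀`, and for every `β` the circuit-number test (`|c β| ≤ Θ`, or `f β` even and `−Θ ≤ c β`).
Conclusion: `b a₀ − ∑_β X β a₀` is a lower bound of the polynomial on `ℝⁿ` — «`p + GP_opt − b₀ =
∑_β p_β ≥ 0`. Hence, `b₀ − GP_opt` is a lower bound of `p`».
[cite: MagronSeidlerDewolff2019, §2.2 (program (SONC)) and Algorithm 3.1 (output: «C is a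
lower bound for p»)] -/
theorem sonc_lowerBound {e : A → n → ℕ} (he : ∀ a i, Even (e a i)) {a₀ : A}
    (he0 : ∀ i, e a₀ i = 0) {f : B → n → ℕ} {b : A → ℝ} {c : B → ℝ} {X w : B → A → ℝ}
    (hX : ∀ β a, 0 ≤ X β a) (hw : ∀ β a, 0 ≤ w β a) (hw1 : ∀ β, ∑ a, w β a = 1)
    (hbary : ∀ β i, (f β i : ℝ) = ∑ a, w β a * e a i)
    (hcol : ∀ a, a ≠ a₀ → ∑ β, X β a ≤ b a)
    (hcirc : ∀ β, |c β| ≤ circuitNumber (X β) (w β) ∨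
      ((∀ i, Even (f β i)) ∧ -circuitNumber (X β) (w β) ≤ c β))
    (x : n → ℝ) :
    b a₀ - ∑ β, X β a₀ ≤ (∑ a, b a * ∏ i, x i ^ e a i) + ∑ β, c β * ∏ i, x i ^ f β i := by
  -- every circuit polynomial `p_β = ∑_a X β a · x^{e a} + c β · x^{f β}` is nonnegative
  have hp : ∀ β, 0 ≤ (∑ a, X β a * ∏ i, x i ^ e a i) + c β * ∏ i, x i ^ f β i := fun β => by
    rcases hcirc β with h | ⟨hfe, h⟩
    · exact circuitPolynomial_nonneg_of_abs_le (hX β) (hw β) (hw1 β) he (hbary β) h x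
    · exact circuitPolynomial_nonneg_of_neg_le (hX β) (hw β) (hw1 β) he (hbary β) hfe h x
  have hmono : ∀ a, 0 ≤ ∏ i, x i ^ e a i := fun a => prod_nonneg fun i _ => (he a i).pow_nonneg _
  have h0 : ∏ i, x i ^ e a₀ i = 1 := by simp [he0]
  -- regroup `∑_β p_β` by monomials
  have hsum : (∑ β, ((∑ a, X β a * ∏ i, x i ^ e a i) + c β * ∏ i, x i ^ f β i))
      = (∑ a, (∑ β, X β a) * ∏ i, x i ^ e a i) + ∑ β, c β * ∏ i, x i ^ f β i := by
    rw [sum_add_distrib, sum_comm]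
    simp_rw [sum_mul]
  have hdiff : (∑ a, b a * ∏ i, x i ^ e a i) - ∑ a, (∑ β, X β a) * ∏ i, x i ^ e a i
      = ∑ a, (b a - ∑ β, X β a) * ∏ i, x i ^ e a i := by
    rw [← sum_sub_distrib]
    exact sum_congr rfl fun a _ => by ring
  -- split off the constant monomial; the other slack terms are nonnegative
  have hsplit : ∑ a, (b a - ∑ β, X β a) * ∏ i, x i ^ e a i
      = (b a₀ - ∑ β, X β a₀) + ∑ a ∈ univ.erase a₀, (b a - ∑ β, X β a) * ∏ i, x i ^ e a i := by
    rw [← add_sum_erase _ _ (mem_univ a₀), h0, mul_one]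
  have hrest : 0 ≤ ∑ a ∈ univ.erase a₀, (b a - ∑ β, X β a) * ∏ i, x i ^ e a i :=
    sum_nonneg fun a ha => mul_nonneg (sub_nonneg.mpr (hcol a (ne_of_mem_erase ha))) (hmono a)
  have hpos : 0 ≤ ∑ β, ((∑ a, X β a * ∏ i, x i ^ e a i) + c β * ∏ i, x i ^ f β i) :=
    sum_nonneg fun β _ => hp β
  linarith [hsum, hsplit, hrest, hdiff, hpos]

/-- **SONC membership certifies nonnegativity** (Definition 3: `C_{n,2d}` = sums of nonnegative
circuit polynomials): if in addition the constant column passes, `∑_β X β a₀ ≤ b a₀`, i.e. the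
polynomial dominates a sum of certified circuit polynomials coefficientwise on the monomial
squares, then it is nonnegative on `ℝⁿ`.
[cite: MagronSeidlerDewolff2019, Definition 3 and Theorem 2.1] -/
theorem sonc_nonneg {e : A → n → ℕ} (he : ∀ a i, Even (e a i)) {a₀ : A}
    (he0 : ∀ i, e a₀ i = 0) {f : B → n → ℕ} {b : A → ℝ} {c : B → ℝ} {X w : B → A → ℝ}
    (hX : ∀ β a, 0 ≤ X β a) (hw : ∀ β a, 0 ≤ w β a) (hw1 : ∀ β, ∑ a, w β a = 1)
    (hbary : ∀ β i, (f β i : ℝ) = ∑ a, w β a * e a i)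
    (hcol : ∀ a, ∑ β, X β a ≤ b a)
    (hcirc : ∀ β, |c β| ≤ circuitNumber (X β) (w β) ∨
      ((∀ i, Even (f β i)) ∧ -circuitNumber (X β) (w β) ≤ c β))
    (x : n → ℝ) :
    0 ≤ (∑ a, b a * ∏ i, x i ^ e a i) + ∑ β, c β * ∏ i, x i ^ f β i := by
  have h := sonc_lowerBound he he0 hX hw hw1 hbary (fun a _ => hcol a) hcirc x
  linarith [hcol a₀]

end Sonc

/-! ## SAGE: (SAGE-feas) certifies nonnegativity, program (SAGE) a lower bound -/

section Sage

variable {n : Type*} [Fintype n] {ι : Type*} [Fintype ι] [DecidableEq ι]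

/-- **Soundness of SAGE decompositions** (Chandrasekaran–Shah Definition 2; Magron–Seidler–de
Wolff Theorem 2.4, conditions (SAGE-feas) with the strict positivity `c_{∖j}^{(j)} > 0` of
(INTSAGE-feas)).  For a signomial `f(x) = ∑_i b_i exp(α(i)·x)`: coefficient vectors `c^{(j)} =
C j` with `∑_j c^{(j)} = b`, vectors `ν^{(j)} = V j` with `∑_i α(i) ν_i^{(j)} = 0`,
`ν_j^{(j)} = −1·ν_{∖j}^{(j)}`, `ν_{∖j}^{(j)} ≥ 0`, and `D(ν_{∖j}^{(j)}, e c_{∖j}^{(j)}) ≤ c_j^{(j)}`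
for every `j`, imply `f(x) ≥ 0` for all real `x`: each `f_j(x) = ∑_i c_i^{(j)} exp(α(i)·x)` is an
AGE certified by `ν_{∖j}^{(j)}` (Lemma 2.3 ⇐, `signomial_nonneg_of_vecRelEntropy_le`), and
`f = ∑_j f_j`.
[cite: ChandrasekaranShah2016, §2.2, Definition 2 («SAGE functions are globally nonnegative»)]
[cite: MagronSeidlerDewolff2019, Theorem 2.4 ((SAGE-feas)) and §4 ((INTSAGE-feas))] -/
theorem sage_nonneg {α : ι → n → ℝ} {b : ι → ℝ} {C V : ι → ι → ℝ}
    (hsum : ∀ i, ∑ j, C j i = b i)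
    (hpos : ∀ j i, i ≠ j → 0 < C j i) (hν : ∀ j i, i ≠ j → 0 ≤ V j i)
    (hzero : ∀ j k, ∑ i, V j i * α i k = 0)
    (hdiag : ∀ j, V j j = -∑ i ∈ univ.erase j, V j i)
    (hD : ∀ j, ∑ i ∈ univ.erase j, V j i * Real.log (V j i / (Real.exp 1 * C j i)) ≤ C j j)
    (x : n → ℝ) : 0 ≤ ∑ i, b i * Real.exp (dotProduct (α i) x) := by
  have hsub : ∀ (j : ι) (g : ι → ℝ), ∑ i ∈ univ.erase j, g i = ∑ i : {i // i ≠ j}, g i :=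
    fun j g => sum_subtype _ (fun i => by simp) g
  -- each AGE piece `f_j = ∑_{i ≠ j} C j i e^{α(i)·x} + C j j e^{α(j)·x}` is nonnegative
  have hage : ∀ j, 0 ≤ (∑ i : {i // i ≠ j}, C j i * Real.exp (dotProduct (α i) x))
      + C j j * Real.exp (dotProduct (α j) x) := fun j => by
    have hbal : ∀ k, ∑ i : {i // i ≠ j}, V j i * α i k = (∑ i : {i // i ≠ j}, V j i) * α j k := by
      intro k
      rw [← hsub j (fun i => V j i * α i k), ← hsub j (fun i => V j i)]
      have h := hzero j k
      rw [← add_sum_erase _ _ (mem_univ j), hdiag j, neg_mul] at h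
      linarith
    have hD' : vecRelEntropy (fun i : {i // i ≠ j} => V j i) (fun i => Real.exp 1 * C j i)
        ≤ C j j := by
      unfold vecRelEntropy
      rw [← hsub j (fun i => V j i * Real.log (V j i / (Real.exp 1 * C j i)))]
      exact hD j
    exact signomial_nonneg_of_vecRelEntropy_le (c := fun i : {i // i ≠ j} => C j i)
      (ν := fun i : {i // i ≠ j} => V j i) (fun i => hpos j i i.2) (fun i => hν j i i.2) hbal hD' x
  -- regroup `f = ∑_j f_j`
  have hf : ∑ i, b i * Real.exp (dotProduct (α i) x)
      = ∑ j, ((∑ i : {i // i ≠ j}, C j i * Real.exp (dotProduct (α i) x))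
        + C j j * Real.exp (dotProduct (α j) x)) := by
    calc ∑ i, b i * Real.exp (dotProduct (α i) x)
        = ∑ i, ∑ j, C j i * Real.exp (dotProduct (α i) x) := by
          refine sum_congr rfl fun i _ => ?_
          rw [← hsum i, sum_mul]
      _ = ∑ j, ∑ i, C j i * Real.exp (dotProduct (α i) x) := sum_comm
      _ = _ := by
          refine sum_congr rfl fun j _ => ?_
          rw [← add_sum_erase _ _ (mem_univ j),
            hsub j (fun i => C j i * Real.exp (dotProduct (α i) x)), add_comm]
  rw [hf]
  exact sum_nonneg fun j _ => hage j

/-- **Program (SAGE) certifies a lower bound**: `f_SAGE = sup {λ : f − λ ∈ C_SAGE}`; concretely,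
if the term `i₀` of `f` is the constant one (`α(i₀) = 0`) and the coefficient vector of `f − λ`
(i.e. `b` with `b_{i₀}` replaced by `b_{i₀} − λ`) admits a SAGE certificate as in `sage_nonneg`,
then `λ ≤ f(x)` for all real `x`.
[cite: MagronSeidlerDewolff2019, §2.3 (program (SAGE): «the constraints of (SAGE) correspond to
(SAGE-feas), after replacing b by the vector of coefficients of f − λ») and Algorithm 3.3] -/
theorem sage_lowerBound {α : ι → n → ℝ} {b : ι → ℝ} {i₀ : ι} (hα0 : α i₀ = 0) (lam : ℝ)
    {C V : ι → ι → ℝ} (hsum : ∀ i, ∑ j, C j i = if i = i₀ then b i - lam else b i)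
    (hpos : ∀ j i, i ≠ j → 0 < C j i) (hν : ∀ j i, i ≠ j → 0 ≤ V j i)
    (hzero : ∀ j k, ∑ i, V j i * α i k = 0)
    (hdiag : ∀ j, V j j = -∑ i ∈ univ.erase j, V j i)
    (hD : ∀ j, ∑ i ∈ univ.erase j, V j i * Real.log (V j i / (Real.exp 1 * C j i)) ≤ C j j)
    (x : n → ℝ) : lam ≤ ∑ i, b i * Real.exp (dotProduct (α i) x) := by
  have h := sage_nonneg (b := fun i => if i = i₀ then b i - lam else b i) hsum hpos hν hzero
    hdiag hD x
  beta_reduce at h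
  have hsplit : ∑ i, (if i = i₀ then b i - lam else b i) * Real.exp (dotProduct (α i) x)
      = (∑ i, b i * Real.exp (dotProduct (α i) x)) - lam := by
    have h1 : ∀ i, (if i = i₀ then b i - lam else b i) * Real.exp (dotProduct (α i) x)
        = b i * Real.exp (dotProduct (α i) x)
          - (if i = i₀ then lam * Real.exp (dotProduct (α i) x) else 0) := by
      intro i
      split_ifs <;> ring
    simp_rw [h1]
    rw [sum_sub_distrib]
    simp [hα0]
  linarith [hsplit]

end Sage

end Literature.Algebra.Polynomial.SoncSageDecompositions
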